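import Summits.QuantumFields.YangMills.Theorems.UnitScaleTiltProp7FlatTargetOfLODLine
import Summits.QuantumFields.YangMills.Theorems.UnitScaleTiltProp7IMSSumOfSquaresLocalisation
import HarnessLib

/-!
# Route `UnitScaleTilt`, crux K1 «MinimiserStabilityRegPr» (stmt-QuantumFields-19200), EX row `hGF` (curved member) — **(L6) THE LOD ASSEMBLY AT THE MEMBER, IN HYPOTHESIS FORM**
# (LOCATE-L6-ASSEMBLY-p1g24 §1 Org-I, Steps I.1–I.4 composed over the member's letters `Δ^η(U₀)`, `projR(covLapSite U₀)Q″D*_{U₀}`, `Q_k(U₀)`; every supplier row a named binder)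

Cell `ym3-torus` (HUMAN RULING D-0037, rung R3 — NOT d = 4, NOT a mass gap, NOT Clay).  Width seat `ym-ust-19200-w5` (gen 13); chair ★`ym-ust-19200-p1` g24 («(L6) w5»).  THEOREMS ONLY
(0 `def`, 0 `sorry`); `--supports stmt-QuantumFields-19200 --as helper`.  HONEST LABEL (№33 (6)): the KNIT of the LOD line with the member rows as HYPOTHESES — it proves the slice row
`γ‖A‖² ≤ re⟪A, Δ^η(U₀)A⟫ + a‖Q_k(U₀)A‖²` on `{R_S(U₀)D*A = 0}` ONLY CONDITIONALLY on those rows; nothing of (3.49), `h349`, `hGF`, EX or the crux is proved here.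

THE SHAPE (so each supplier types its row once, in this currency).  `E` = bond fields `BondL2K`, `S` = gauge parameters `SiteL2K`, `C` = the coarse space of `Q_k`;
`q_U(A) := re⟪A, Δ^η(U₀)A⟫ + ‖T₂ A‖² + a·‖Q_k(U₀)A‖²` (print's (3.49) functional at the member; `T₂ = projR(covLapSite U₀)Q″ ∘ D*_{U₀}` the LOD gauge term, kept GENERIC).  Binders:
* (χ) pen (L6-χ): cut-offs `M_j : E →ₗ E`, `N₂,j : S →ₗ S`, `N₃,j : C →ₗ C` with `Σ_j ‖M_j A‖² = ‖A‖²`, `Σ_j ‖N_{s,j} y‖² ≤ ‖y‖²`;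
* (H) the Hessian row in RELATIVE shape (★p1 g24 00:21:36Z pin; pen (L6-curl) via the squares road on `re⟪X,Δ^ηX⟫ = c₀η⁻²CURL + c₀η⁻²P`, ✓p750892):
  `Σ_j re⟪M_jA, Δ^η M_jA⟫ ≤ (1+θ)·re⟪A, Δ^η A⟫ + ρ‖A‖²` (same `θ` as the squares; an exact kernel-IMS row docks via ✓`hessianRow_rel_of_exact`);
* (K) first-order commutator budgets `Σ_j ‖T₂(M_jA) − N₂,j(T₂A)‖² ≤ κ₂²‖A‖² + μ₂·q_U(A)`, `a·Σ_j ‖Q_k(M_jA) − N₃,j(Q_kA)‖² ≤ κ₃²‖A‖² + μ₃·q_U(A)` ((L5″)∕(L5′)∕(L6-χ),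
  the relative part through ✓`Prop7RTermFloor.normSq_adjoint_le_normSq_projR_add`);
* (F) a flat target `γ_f‖B‖² ≤ q₁(B)` on a comparison space `G` (✓`Prop7FlatTargetOfLODLine.flat_target_topMean`, §3 discharges it) and (C) the LOCAL COMPARISON rows
  `(1 − θ′)·q₁(Φ_j(M_jA)) − e·‖M_jA‖² ≤ q_U(M_jA)` with `‖Φ_j(M_jA)‖ = ‖M_jA‖` ((L5a)(L5b)(L5c)(L5″) + gauge covariance ✓`Prop7LocalLaplacianGaugeCovariance`).
OUTPUT: the CURVED TARGET `γ_LOD·‖A‖² ≤ q_U(A)` for every `A`, `γ_LOD = ((1−θ′)γ_f − e − ρ − (1+θ⁻¹)(κ₂²+κ₃²)) ∕ (1 + θ + (1+θ⁻¹)(μ₂+μ₃))` = the body of the binder `hT` of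
✓`Prop7GaugeFixedRowDoorOfLODTarget.gaugeFixedRow_of_curvedTarget` (which turns it into S44ᴸγ's `hGF[Lift]` row); the composition is ✓`Prop7IMSSumOfSquaresLocalisation.floor_of_localisation_rel`.

WHAT IS PROVED (ns `…Theorems.Prop7LODAssembly`).
* §1 `localFloor_of_comparison` (real arithmetic: flat target + isometry + relative comparison ⟹ local floor `(1−θ′)γ_f − e`).
* §2 ★★★ `curvedTarget_of_LOD` (the knit, all `A`, generic middle map `T₂` and flat functional `q₁`) and ★★ `gaugeFixedFloor_of_LOD` (its reading on `{T₂ A = 0}`).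
* §3 ★★★ `curvedTarget_of_LOD_topMean` (the knit at `T₂ := projR(covLapSite U₀)Q_U ∘ D*_{U₀}` with (F) DISCHARGED by ✓`flat_target_topMean` at `a = a₀(c₀∕cB)(L^{K−n})³`,
  `γ_f = 1∕(4·Cst 3 a₀)`, comparison functional `q₁(B) = re⟪B, Δ^η(1)B⟫ + ‖projR(covLapSite 1)Q₁(D*_1B)‖² + a‖Q_k(1)B‖²` — the body of `hT`).
WHY IT MIGHT FAIL: the knit cannot; the line fails iff a supplier row fails K-uniformly (`ρ, κ², e = O(R′⁻²) + O(R″²ε₀²)`-class must sit below `γ_f∕2`) or the small-member case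
(`sitesPerDir (K−n) < 2R′`, LOCATE-L4-IMS §(iii)) needs its own certificate.

References: T. Bałaban, CMP **99** (1985) 389–434 [Balaban1985BackgroundPropagators] ((3.49) p.399, Thm 3.11 p.416, (3.118)–(3.122) pp.419–420); B. Simon, Ann. IHP A **38** (1983) 295–308.
-/

set_option autoImplicit false

noncomputable section

open scoped InnerProductSpace ComplexConjugate Matrix.Norms.L2Operator BigOperators

namespace Summit.QuantumFields.YangMills.Theorems.Prop7LODAssembly

open Literature.MathematicalPhysics.QuantumFieldTheory.Balaban1983to89
open Literature.MathematicalPhysics.QuantumFieldTheory.Balaban1983to89.T3ContinuumYM3Torus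
open T4Continuum BlockAveraging
open BlockAveraging (Idx)
open B7Prop1Explicit (disp)
open B10Eq27TorusAxialLog (holT transl)
open B7TransferAnalyticMean (meanCLM)
open B9Eq311L2Pairing (WL2)
open B11Eq103H1Complex (SiteL2K BondL2K projR)
open B15DeterminingSets (embIter)
open Summit.QuantumFields.YangMills.Theorems.Prop8Chart (emlIterU)
open T3SectALandauChart (bgUnits bgUnits_one)
open Summit.QuantumFields.YangMills.Theorems.Prop7SectET3Transport (periodsT3)
open Summit.QuantumFields.YangMills.Theorems.Prop7SectET3HilbertLetters (W₂ toL2S DL2 DstarL2 covLapSite)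
open Summit.QuantumFields.YangMills.Theorems.Prop7SectET3GaugeProjector (NS RS)
open Summit.QuantumFields.YangMills.Theorems.Prop7SectET3WilsonHessian (DeltaEta)
open Summit.QuantumFields.YangMills.Theorems.Prop7SectET3CurvedPropagators (Qk)
open Summit.QuantumFields.YangMills.Theorems.Prop7IMSSumOfSquaresLocalisation (floor_of_localisation_rel)
open Summit.QuantumFields.YangMills.Theorems.Prop7FlatTargetOfLODLine (flat_target_topMean RS_one_eq_projR_topMean)

variable {F : T3Family} {n K : ℕ} {h : n ≤ K} {c₀ cB : ℝ} [Fact (0 < c₀)] [Fact (0 < cB)]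

/-! ## §1 Local floors from the flat target and a relative comparison -/

/-- Flat target `γ_f·n′² ≤ q₁′`, isometry `n′ = n`, relative comparison `(1 − θ′)·q₁′ − e·n² ≤ q_U` (`θ′ ≤ 1`) ⟹ local floor `((1 − θ′)γ_f − e)·n² ≤ q_U`. [folklore] -/
theorem localFloor_of_comparison {γf θ' e nB nB' q1B' qUB : ℝ} (hθ' : θ' ≤ 1)
    (h1 : γf * nB' ^ 2 ≤ q1B') (hΦ : nB' = nB) (h2 : (1 - θ') * q1B' - e * nB ^ 2 ≤ qUB) :
    ((1 - θ') * γf - e) * nB ^ 2 ≤ qUB := by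
  subst hΦ
  have h3 : (1 - θ') * (γf * nB' ^ 2) ≤ (1 - θ') * q1B' := mul_le_mul_of_nonneg_left h1 (by linarith)
  linarith

/-! ## §2 The knit -/

/-- ★★★ **THE LOD ASSEMBLY AT THE MEMBER (hypothesis form, all-`A` target).**  For any background `U₀`, weight `a ≥ 0` and ANY middle map `T₂` (at the member: `projR(covLapSite U₀)Q″ ∘ D*_{U₀}`,
the LOD∕print gauge term): cut-off rows (χ), Hessian rows (H), commutator budgets (K), a flat target (F) on a comparison space and the local comparison rows (C) — dictionary in the module
docstring — give the CURVED TARGET `γ_LOD·‖A‖² ≤ re⟪A, Δ^η(U₀)A⟫ + ‖T₂ A‖² + a‖Q_k(U₀)A‖²` for EVERY `A`, `γ_LOD = ((1−θ′)γ_f − e − ρ − (1+θ⁻¹)(κ₂²+κ₃²))∕(1 + θ + (1+θ⁻¹)(μ₂+μ₃))`.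
Conditional on the rows; the composition is ✓`floor_of_localisation_rel`. [cite: Balaban1985BackgroundPropagators, (3.49) p.399, Thm 3.11 p.416] -/
theorem curvedTarget_of_LOD (U₀ : GaugeField (F.P K) 0 (Matrix.specialUnitaryGroup (Fin 2) ℂ)) {a : ℝ} (ha : 0 ≤ a)
    {J : Type*} [Fintype J] {G S' : Type*} [SeminormedAddCommGroup G] [SeminormedAddCommGroup S']
    (M : J → BondL2K ℂ 3 (periodsT3 F K) c₀ W₂ →ₗ[ℂ] BondL2K ℂ 3 (periodsT3 F K) c₀ W₂)
    (T₂ : BondL2K ℂ 3 (periodsT3 F K) c₀ W₂ → S') (N₂ : J → S' → S')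
    (N₃ : J → WL2 ℂ (fun _ : PBond (F.P n) 0 => cB) W₂ →ₗ[ℂ] WL2 ℂ (fun _ : PBond (F.P n) 0 => cB) W₂)
    (q1 : G → ℝ) (Φ : J → BondL2K ℂ 3 (periodsT3 F K) c₀ W₂ → G)
    {θ θ' γf e ρ κ₂ κ₃ μ₂ μ₃ : ℝ} (hθ : 0 < θ) (hθ' : θ' ≤ 1) (hμ : 0 ≤ μ₂ + μ₃)
    (hM : ∀ A, ∑ j, ‖M j A‖ ^ 2 = ‖A‖ ^ 2)
    (hN₂ : ∀ y, ∑ j, ‖N₂ j y‖ ^ 2 ≤ ‖y‖ ^ 2) (hN₃ : ∀ y, ∑ j, ‖N₃ j y‖ ^ 2 ≤ ‖y‖ ^ 2)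
    (hq₁ : ∀ A, ∑ j, RCLike.re ⟪M j A, DeltaEta F n K c₀ U₀ (M j A)⟫_ℂ ≤ (1 + θ) * RCLike.re ⟪A, DeltaEta F n K c₀ U₀ A⟫_ℂ + ρ * ‖A‖ ^ 2)
    (hK₂ : ∀ A, ∑ j, ‖T₂ (M j A) - N₂ j (T₂ A)‖ ^ 2
      ≤ κ₂ ^ 2 * ‖A‖ ^ 2 + μ₂ * (RCLike.re ⟪A, DeltaEta F n K c₀ U₀ A⟫_ℂ + ‖T₂ A‖ ^ 2 + a * ‖Qk F n K h c₀ cB U₀ A‖ ^ 2))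
    (hK₃ : ∀ A, a * ∑ j, ‖Qk F n K h c₀ cB U₀ (M j A) - N₃ j (Qk F n K h c₀ cB U₀ A)‖ ^ 2
      ≤ κ₃ ^ 2 * ‖A‖ ^ 2 + μ₃ * (RCLike.re ⟪A, DeltaEta F n K c₀ U₀ A⟫_ℂ + ‖T₂ A‖ ^ 2 + a * ‖Qk F n K h c₀ cB U₀ A‖ ^ 2))
    (hflat : ∀ B, γf * ‖B‖ ^ 2 ≤ q1 B) (hΦ : ∀ j A, ‖Φ j (M j A)‖ = ‖M j A‖)
    (hcmp : ∀ j A, (1 - θ') * q1 (Φ j (M j A)) - e * ‖M j A‖ ^ 2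
      ≤ RCLike.re ⟪M j A, DeltaEta F n K c₀ U₀ (M j A)⟫_ℂ + ‖T₂ (M j A)‖ ^ 2 + a * ‖Qk F n K h c₀ cB U₀ (M j A)‖ ^ 2) :
    ∀ A : BondL2K ℂ 3 (periodsT3 F K) c₀ W₂,
      ((1 - θ') * γf - e - ρ - (1 + θ⁻¹) * (κ₂ ^ 2 + κ₃ ^ 2)) / (1 + θ + (1 + θ⁻¹) * (μ₂ + μ₃)) * ‖A‖ ^ 2
        ≤ RCLike.re ⟪A, DeltaEta F n K c₀ U₀ A⟫_ℂ + ‖T₂ A‖ ^ 2 + a * ‖Qk F n K h c₀ cB U₀ A‖ ^ 2 := by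
  intro A
  -- the `Q_k` square as door data
  have hsa : ‖((Real.sqrt a : ℝ) : ℂ)‖ ^ 2 = a := by
    rw [Complex.norm_real, Real.norm_eq_abs, abs_of_nonneg (Real.sqrt_nonneg a), Real.sq_sqrt ha]
  have hT3 : ∀ B : BondL2K ℂ 3 (periodsT3 F K) c₀ W₂, ‖((Real.sqrt a : ℝ) : ℂ) • Qk F n K h c₀ cB U₀ B‖ ^ 2 = a * ‖Qk F n K h c₀ cB U₀ B‖ ^ 2 := fun B => by
    rw [norm_smul, mul_pow, hsa]
  have hK3d : ∀ B : BondL2K ℂ 3 (periodsT3 F K) c₀ W₂, ∀ j,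
      ‖((Real.sqrt a : ℝ) : ℂ) • Qk F n K h c₀ cB U₀ (M j B) - N₃ j (((Real.sqrt a : ℝ) : ℂ) • Qk F n K h c₀ cB U₀ B)‖ ^ 2
        = a * ‖Qk F n K h c₀ cB U₀ (M j B) - N₃ j (Qk F n K h c₀ cB U₀ B)‖ ^ 2 := fun B j => by
    rw [LinearMap.map_smul, ← smul_sub, norm_smul, mul_pow, hsa]
  -- local floors
  have hloc : ∀ j (B : BondL2K ℂ 3 (periodsT3 F K) c₀ W₂), ((1 - θ') * γf - e) * ‖M j B‖ ^ 2
      ≤ RCLike.re ⟪M j B, DeltaEta F n K c₀ U₀ (M j B)⟫_ℂ + ‖T₂ (M j B)‖ ^ 2 + ‖((Real.sqrt a : ℝ) : ℂ) • Qk F n K h c₀ cB U₀ (M j B)‖ ^ 2 := fun j B => by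
    rw [hT3]
    exact localFloor_of_comparison hθ' (hflat (Φ j (M j B))) (hΦ j B) (hcmp j B)
  -- the door
  have hdoor := floor_of_localisation_rel (J := J)
    (fun B : BondL2K ℂ 3 (periodsT3 F K) c₀ W₂ => RCLike.re ⟪B, DeltaEta F n K c₀ U₀ B⟫_ℂ)
    T₂ (fun B => ((Real.sqrt a : ℝ) : ℂ) • Qk F n K h c₀ cB U₀ B)
    (fun j B => M j B) N₂ (fun j y => N₃ j y)
    (θ := θ) (σ := (1 - θ') * γf - e) (ρ := ρ) (κ₂ := κ₂) (κ₃ := κ₃) (μ₂ := μ₂) (μ₃ := μ₃)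
    hθ hM hN₂ hN₃ hq₁ (fun B => by simpa only [hT3] using hK₂ B)
    (fun B => by simpa only [hK3d, hT3, ← Finset.mul_sum] using hK₃ B) hloc A
  rw [hT3] at hdoor
  have hden : 0 < 1 + θ + (1 + θ⁻¹) * (μ₂ + μ₃) := by positivity
  rw [div_mul_eq_mul_div, div_le_iff₀ hden]
  linarith [hdoor]

/-- ★★ **THE SLICE ROW** (the `hGF`-row shape of S44ᴸγ): on `{T₂ A = 0}` — e.g. `T₂ = R_S(U₀)∘D*_{U₀}` on the gauge-fixed slice, or `projR(covLapSite U₀)Q″∘D*_{U₀}` behind the Lift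
clause (✓`Prop7GaugeFixedRowDoorOfLODTarget.projR_DstarL2_eq_zero_of_lift`) — the curved target of `curvedTarget_of_LOD` reads `γ_LOD·‖A‖² ≤ re⟪A, Δ^η(U₀)A⟫ + a‖Q_k(U₀)A‖²`.
[cite: Balaban1985BackgroundPropagators, (3.49) p.399] -/
theorem gaugeFixedFloor_of_LOD (U₀ : GaugeField (F.P K) 0 (Matrix.specialUnitaryGroup (Fin 2) ℂ)) {a : ℝ} (ha : 0 ≤ a)
    {J : Type*} [Fintype J] {G S' : Type*} [SeminormedAddCommGroup G] [NormedAddCommGroup S']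
    (M : J → BondL2K ℂ 3 (periodsT3 F K) c₀ W₂ →ₗ[ℂ] BondL2K ℂ 3 (periodsT3 F K) c₀ W₂)
    (T₂ : BondL2K ℂ 3 (periodsT3 F K) c₀ W₂ → S') (N₂ : J → S' → S')
    (N₃ : J → WL2 ℂ (fun _ : PBond (F.P n) 0 => cB) W₂ →ₗ[ℂ] WL2 ℂ (fun _ : PBond (F.P n) 0 => cB) W₂)
    (q1 : G → ℝ) (Φ : J → BondL2K ℂ 3 (periodsT3 F K) c₀ W₂ → G)
    {θ θ' γf e ρ κ₂ κ₃ μ₂ μ₃ : ℝ} (hθ : 0 < θ) (hθ' : θ' ≤ 1) (hμ : 0 ≤ μ₂ + μ₃)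
    (hM : ∀ A, ∑ j, ‖M j A‖ ^ 2 = ‖A‖ ^ 2)
    (hN₂ : ∀ y, ∑ j, ‖N₂ j y‖ ^ 2 ≤ ‖y‖ ^ 2) (hN₃ : ∀ y, ∑ j, ‖N₃ j y‖ ^ 2 ≤ ‖y‖ ^ 2)
    (hq₁ : ∀ A, ∑ j, RCLike.re ⟪M j A, DeltaEta F n K c₀ U₀ (M j A)⟫_ℂ ≤ (1 + θ) * RCLike.re ⟪A, DeltaEta F n K c₀ U₀ A⟫_ℂ + ρ * ‖A‖ ^ 2)
    (hK₂ : ∀ A, ∑ j, ‖T₂ (M j A) - N₂ j (T₂ A)‖ ^ 2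
      ≤ κ₂ ^ 2 * ‖A‖ ^ 2 + μ₂ * (RCLike.re ⟪A, DeltaEta F n K c₀ U₀ A⟫_ℂ + ‖T₂ A‖ ^ 2 + a * ‖Qk F n K h c₀ cB U₀ A‖ ^ 2))
    (hK₃ : ∀ A, a * ∑ j, ‖Qk F n K h c₀ cB U₀ (M j A) - N₃ j (Qk F n K h c₀ cB U₀ A)‖ ^ 2
      ≤ κ₃ ^ 2 * ‖A‖ ^ 2 + μ₃ * (RCLike.re ⟪A, DeltaEta F n K c₀ U₀ A⟫_ℂ + ‖T₂ A‖ ^ 2 + a * ‖Qk F n K h c₀ cB U₀ A‖ ^ 2))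
    (hflat : ∀ B, γf * ‖B‖ ^ 2 ≤ q1 B) (hΦ : ∀ j A, ‖Φ j (M j A)‖ = ‖M j A‖)
    (hcmp : ∀ j A, (1 - θ') * q1 (Φ j (M j A)) - e * ‖M j A‖ ^ 2
      ≤ RCLike.re ⟪M j A, DeltaEta F n K c₀ U₀ (M j A)⟫_ℂ + ‖T₂ (M j A)‖ ^ 2 + a * ‖Qk F n K h c₀ cB U₀ (M j A)‖ ^ 2)
    (A : BondL2K ℂ 3 (periodsT3 F K) c₀ W₂) (hA : T₂ A = 0) :
    ((1 - θ') * γf - e - ρ - (1 + θ⁻¹) * (κ₂ ^ 2 + κ₃ ^ 2)) / (1 + θ + (1 + θ⁻¹) * (μ₂ + μ₃)) * ‖A‖ ^ 2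
      ≤ RCLike.re ⟪A, DeltaEta F n K c₀ U₀ A⟫_ℂ + a * ‖Qk F n K h c₀ cB U₀ A‖ ^ 2 := by
  have h1 := curvedTarget_of_LOD U₀ ha M T₂ N₂ N₃ q1 Φ hθ hθ' hμ hM hN₂ hN₃ hq₁ hK₂ hK₃ hflat hΦ hcmp A
  rw [hA, norm_zero, zero_pow two_ne_zero, add_zero] at h1
  exact h1

/-! ## §3 The knit with the flat target discharged: the `hT` binder of the γ-row door -/

/-- ★★★ **THE LOD ASSEMBLY WITH THE FLAT TARGET OF RECORD — THE BODY OF `hT`.**  §2 at the member's middle map `T₂ := projR(covLapSite U₀)Q_U ∘ D*_{U₀}` (any intertwiner `Q_U`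
of the curved background) with (F) DISCHARGED: at `a = a₀·(c₀∕cB)·(L^(K−n))³` the flat functional `q₁(B) = re⟪B, Δ^η(1)B⟫ + ‖projR(covLapSite 1)Q₁(D*_1 B)‖² + a‖Q_k(1)B‖²`
has the floor `γ_f = 1∕(4·Cst 3 a₀)` for ALL `B` (✓`flat_target_topMean`, given clause (iv) `htop₁` ∕ (v) `hker₁` of ✓`exists_intertwiner_of_regPr` at `U₀ := 1` for `Q₁`).  OUTPUT = the body
of the binder `hT` of ✓`Prop7GaugeFixedRowDoorOfLODTarget.gaugeFixedRow_of_curvedTarget` at `Q″ := Q_U`, with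
`γ := ((1−θ′)∕(4·Cst 3 a₀) − e − ρ − (1+θ⁻¹)(κ₂²+κ₃²))∕(1 + θ + (1+θ⁻¹)(μ₂+μ₃))` — conditional on the rows (χ)(H)(K)(C) at this `Q_U`.
[cite: Balaban1984PropagatorsI, Prop. 1.1 (1.90) p.33; Balaban1985BackgroundPropagators, (3.49) p.399, Thm 3.11 p.416] -/
theorem curvedTarget_of_LOD_topMean (U₀ : GaugeField (F.P K) 0 (Matrix.specialUnitaryGroup (Fin 2) ℂ))
    (QU : SiteL2K ℂ 3 (periodsT3 F K) c₀ W₂ →ₗ[ℂ] (Site (F.P K) (K - n) → Matrix (Fin 2) (Fin 2) ℂ)) {a₀ : ℝ} (ha₀ : 0 < a₀)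
    (Q1 : SiteL2K ℂ 3 (periodsT3 F K) c₀ W₂ →ₗ[ℂ] (Site (F.P K) (K - n) → Matrix (Fin 2) (Fin 2) ℂ))
    (htop₁ : ∀ (lam : Site (F.P K) 0 → Matrix (Fin 2) (Fin 2) ℂ) (ns : (j : ℕ) → Site (F.P K) j → Matrix (Fin 2) (Fin 2) ℂ), ns 0 = lam →
      (∀ (j : ℕ) (y : Site (F.P K) (j + 1)), ns (j + 1) y = ns j (emb y) - meanCLM (Idx (F.P K)) (Matrix (Fin 2) (Fin 2) ℂ) fun i : Idx (F.P K) =>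
        ns j (emb y) - ((holT (emlIterU j (bgUnits F K (1 : GaugeField (F.P K) 0 (Matrix.specialUnitaryGroup (Fin 2) ℂ)))) (emb y) (stairWord i.2.1 (off i.1)) : (Matrix (Fin 2) (Fin 2) ℂ)ˣ) : Matrix (Fin 2) (Fin 2) ℂ) *
          ns j (transl (emb y) (disp (stairWord i.2.1 (off i.1)))) *
          (((holT (emlIterU j (bgUnits F K (1 : GaugeField (F.P K) 0 (Matrix.specialUnitaryGroup (Fin 2) ℂ)))) (emb y) (stairWord i.2.1 (off i.1)))⁻¹ : (Matrix (Fin 2) (Fin 2) ℂ)ˣ) : Matrix (Fin 2) (Fin 2) ℂ)) →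
      ns (K - n) = Q1 (toL2S F K c₀ lam))
    (hker₁ : LinearMap.ker Q1 ≤ NS F n K h c₀ cB (1 : GaugeField (F.P K) 0 (Matrix.specialUnitaryGroup (Fin 2) ℂ)))
    {J : Type*} [Fintype J]
    (M : J → BondL2K ℂ 3 (periodsT3 F K) c₀ W₂ →ₗ[ℂ] BondL2K ℂ 3 (periodsT3 F K) c₀ W₂)
    (N₂ : J → SiteL2K ℂ 3 (periodsT3 F K) c₀ W₂ → SiteL2K ℂ 3 (periodsT3 F K) c₀ W₂)
    (N₃ : J → WL2 ℂ (fun _ : PBond (F.P n) 0 => cB) W₂ →ₗ[ℂ] WL2 ℂ (fun _ : PBond (F.P n) 0 => cB) W₂)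
    (Φ : J → BondL2K ℂ 3 (periodsT3 F K) c₀ W₂ → BondL2K ℂ 3 (periodsT3 F K) c₀ W₂)
    {θ θ' e ρ κ₂ κ₃ μ₂ μ₃ : ℝ} (hθ : 0 < θ) (hθ' : θ' ≤ 1) (hμ : 0 ≤ μ₂ + μ₃)
    (hM : ∀ A, ∑ j, ‖M j A‖ ^ 2 = ‖A‖ ^ 2)
    (hN₂ : ∀ y, ∑ j, ‖N₂ j y‖ ^ 2 ≤ ‖y‖ ^ 2) (hN₃ : ∀ y, ∑ j, ‖N₃ j y‖ ^ 2 ≤ ‖y‖ ^ 2)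
    (hq₁ : ∀ A, ∑ j, RCLike.re ⟪M j A, DeltaEta F n K c₀ U₀ (M j A)⟫_ℂ ≤ (1 + θ) * RCLike.re ⟪A, DeltaEta F n K c₀ U₀ A⟫_ℂ + ρ * ‖A‖ ^ 2)
    (hK₂ : ∀ A, ∑ j, ‖projR (covLapSite F n K c₀ U₀) QU (DstarL2 F n K c₀ U₀ (M j A)) - N₂ j (projR (covLapSite F n K c₀ U₀) QU (DstarL2 F n K c₀ U₀ A))‖ ^ 2
      ≤ κ₂ ^ 2 * ‖A‖ ^ 2 + μ₂ * (RCLike.re ⟪A, DeltaEta F n K c₀ U₀ A⟫_ℂ + ‖projR (covLapSite F n K c₀ U₀) QU (DstarL2 F n K c₀ U₀ A)‖ ^ 2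
        + (a₀ * (c₀ / cB) * ((F.L : ℝ) ^ (K - n)) ^ 3) * ‖Qk F n K h c₀ cB U₀ A‖ ^ 2))
    (hK₃ : ∀ A, (a₀ * (c₀ / cB) * ((F.L : ℝ) ^ (K - n)) ^ 3) * ∑ j, ‖Qk F n K h c₀ cB U₀ (M j A) - N₃ j (Qk F n K h c₀ cB U₀ A)‖ ^ 2
      ≤ κ₃ ^ 2 * ‖A‖ ^ 2 + μ₃ * (RCLike.re ⟪A, DeltaEta F n K c₀ U₀ A⟫_ℂ + ‖projR (covLapSite F n K c₀ U₀) QU (DstarL2 F n K c₀ U₀ A)‖ ^ 2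
        + (a₀ * (c₀ / cB) * ((F.L : ℝ) ^ (K - n)) ^ 3) * ‖Qk F n K h c₀ cB U₀ A‖ ^ 2))
    (hΦ : ∀ j A, ‖Φ j (M j A)‖ = ‖M j A‖)
    (hcmp : ∀ j A, (1 - θ') * (RCLike.re ⟪Φ j (M j A), DeltaEta F n K c₀ 1 (Φ j (M j A))⟫_ℂ
        + ‖projR (covLapSite F n K c₀ (1 : GaugeField (F.P K) 0 (Matrix.specialUnitaryGroup (Fin 2) ℂ))) Q1 (DstarL2 F n K c₀ 1 (Φ j (M j A)))‖ ^ 2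
        + (a₀ * (c₀ / cB) * ((F.L : ℝ) ^ (K - n)) ^ 3) * ‖Qk F n K h c₀ cB 1 (Φ j (M j A))‖ ^ 2)
        - e * ‖M j A‖ ^ 2
      ≤ RCLike.re ⟪M j A, DeltaEta F n K c₀ U₀ (M j A)⟫_ℂ + ‖projR (covLapSite F n K c₀ U₀) QU (DstarL2 F n K c₀ U₀ (M j A))‖ ^ 2
        + (a₀ * (c₀ / cB) * ((F.L : ℝ) ^ (K - n)) ^ 3) * ‖Qk F n K h c₀ cB U₀ (M j A)‖ ^ 2) :
    ∀ A : BondL2K ℂ 3 (periodsT3 F K) c₀ W₂,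
      ((1 - θ') * (1 / (4 * B5Prop11Plancherel.Cst 3 a₀)) - e - ρ - (1 + θ⁻¹) * (κ₂ ^ 2 + κ₃ ^ 2)) / (1 + θ + (1 + θ⁻¹) * (μ₂ + μ₃)) * ‖A‖ ^ 2
        ≤ RCLike.re ⟪A, DeltaEta F n K c₀ U₀ A⟫_ℂ + ‖projR (covLapSite F n K c₀ U₀) QU (DstarL2 F n K c₀ U₀ A)‖ ^ 2
          + (a₀ * (c₀ / cB) * ((F.L : ℝ) ^ (K - n)) ^ 3) * ‖Qk F n K h c₀ cB U₀ A‖ ^ 2 := by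
  have hc₀ : 0 < c₀ := Fact.out
  have hcB : 0 < cB := Fact.out
  have ha : 0 ≤ a₀ * (c₀ / cB) * ((F.L : ℝ) ^ (K - n)) ^ 3 := by positivity
  exact curvedTarget_of_LOD U₀ ha M (fun A => projR (covLapSite F n K c₀ U₀) QU (DstarL2 F n K c₀ U₀ A)) N₂ N₃
    (fun B : BondL2K ℂ 3 (periodsT3 F K) c₀ W₂ => RCLike.re ⟪B, DeltaEta F n K c₀ 1 B⟫_ℂ
      + ‖projR (covLapSite F n K c₀ (1 : GaugeField (F.P K) 0 (Matrix.specialUnitaryGroup (Fin 2) ℂ))) Q1 (DstarL2 F n K c₀ 1 B)‖ ^ 2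
      + (a₀ * (c₀ / cB) * ((F.L : ℝ) ^ (K - n)) ^ 3) * ‖Qk F n K h c₀ cB 1 B‖ ^ 2)
    Φ hθ hθ' hμ hM hN₂ hN₃ hq₁ hK₂ hK₃ (flat_target_topMean ha₀ Q1 htop₁ hker₁) hΦ hcmp

end Summit.QuantumFields.YangMills.Theorems.Prop7LODAssembly

end
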